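import Summits.HodgeConjecture.HodgeConjecture.Theses.EndoscopicMiddleDegree
import Summits.HodgeConjecture.HodgeConjecture.Theorems.EndoscopicMiddleDegreeOrthogonalEnvelopedCorrAlgebra
import Literature.AlgebraicGeometry.ShimuraVarieties.HeckeCorrespondenceAction
import Literature.AlgebraicGeometry.HodgeTheory.CorrespondenceActionOfGraph
import Literature.AlgebraicGeometry.HodgeTheory.AnalyticSupport
import Literature.AlgebraicGeometry.HodgeTheory.GAGADimensionProofs
import Literature.AlgebraicGeometry.HodgeTheory.ComplexConjugationHolds
import Literature.AlgebraicTopology.SingularHomology.FiniteDeckTransferPullback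
import Literature.AlgebraicGeometry.HodgeTheory.ComplexGysinHodgeType
import Literature.AlgebraicGeometry.HodgeTheory.HodgeTypePullback
import Literature.AlgebraicGeometry.HodgeTheory.HodgeFiltrationModelsReductionProofs
import Literature.AlgebraicGeometry.HodgeTheory.SupportedClassesHodgeConiveau
import Literature.NumberTheory.Transcendental.DeRhamTheoremMultiplicative

/-!
# Hecke graphs are algebraic WITHOUT algebraizing the level covers: the Chow / analytic-support
# route to `heckeGraphAlgebraic` (crux `EndoscopicMiddleDegree.OrthogonalEnveloped`,
# stmt-HodgeConjecture-14300; third lead lineage, seat c2, cycle 1–2, 2026-08-16)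

THE SHARED CONSTRUCTION STUB of all three lines of this crux (`purity-sorted-hecke-envelope`,
`middle-involution-purity`, `hodge-tate-legible-envelope`; also `IdeatorThreeSketch`) is
`stub_heckePushPull`: for an admissible `g ∉ Γ`, `T_g = c • π₊ π'^*` through a smooth projective
SCHEME `S` with scheme morphisms `π π' : S ⟶ X` — i.e. Riemann existence + GAGA for the level cover
`N_g \ 𝔹`, a construction absent from the tree (seat -1's worker: stub-blocked). But the lines consume it
only through the derived
`heckeGraphAlgebraic : ∃ γ ∈ algebraicClasses (X ⊗ X) (2n), corrAction μ … γ = T_g`,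
and the tree ALREADY proves, unconditionally, that ANALYTICALLY supported classes in degree `2p` are
algebraic: `IsAnalyticallySupported.mem_algebraicClasses` (`HodgeTheory/AnalyticSupport`) fed with
`chow_analyticSet_analytification_holds` (Chow / GAGA §19, `LefschetzOneOneChowProofs`) and
`gaga_le_coheight_of_regularLocus_codim_holds` (GAGA §6, `GAGADimensionProofs`). So the Hecke graph never
has to be a scheme. RESHAPE (registered additively on the crux item, 4 stubs replacing
`stub_heckePushPull` for the purpose of `heckeGraphAlgebraic`):

* the TOPOLOGICAL Hecke graph `F_g = (π, π_g) : N_g \ 𝔹 → (X ⊗ X)(ℂ)` (tree: `levelProj`, `twist`,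
  `AlgPoints.prodEquiv`) and the class `γ_g := D_{X⊗X}⁻¹ (F_{g*} θ)`, `θ` a homology transfer of the
  fundamental class `[X(ℂ)]_μ` to the level cover;
* `stub_transferFundamentalClass` (S0, pure topology of finite deck covers, L): a class `θ ∈ H_n(E)`
  with `p_*(y ⌢ θ) = τ^*(y) ⌢ ξ` for all `y` (chain level: `θ = t_* ξ`, `t` the transfer on CHAINS,
  `p_♯(ψ ⌢ t_♯ σ) = τ^♯ψ ⌢ σ` simplex by simplex — Hatcher §3.G; the cochain half is the tree's
  `FiniteDeckTransfer`);
* `stub_topCorrAction` (T3, cap-product calculus, M–L): the action of `D⁻¹(F_* θ)` through the crux's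
  `corrAction μ` is push–pull, `P_γ β ⌢ [X] = (pr₁ ∘ F)_*((pr₂ ∘ F)^* β ⌢ θ)` (graded commutativity,
  `cupProduct_capProduct`, `capProduct_map`, `gysinMap` unfolding of `complexGysin`);
* `stub_vanishesOffImage` (S2a, M): `D⁻¹(F_* θ)` dies on `Y(ℂ) ∖ F(L)` (the Čech–Poincaré argument of
  the tree's `gysinMap_restrictCompl_eq_zero_of_field`, with "carried by `Y ∖ C`" now immediate since
  `F` factors through `Y ∖ C`);
* `stub_heckeGraphAnalytic` (S2b, XL — THE residual): the image `S_g = F_g(N_g \ 𝔹)` read in a Hodge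
  model of `X ⊗ X` is a closed analytic subset all of whose regular points have codimension
  `≥ 2(m+1) = dim X` (locally the graph of the holomorphic map `π_g ∘ π⁻¹`; needs that `unif|𝔹` is a
  local biholomorphism, i.e. that `Γ` acts freely and properly discontinuously on `𝔹` — discreteness of
  congruence subgroups + torsion-freeness; templates `Geometry/Riemannian/HyperboloidDiscreteAction`,
  `Geometry/Manifold/QuotientManifold` — plus chart plumbing between the ball and the Hodge model).

STATUS (2026-08-16T15:45Z): S0 LANDED p106716 (`Theorems/…TransferFundamentalClass`), T3 LANDED p107091
(`Theorems/…TopCorrAction`), S2a LANDED p106705 (`Theorems/…VanishesOffImage`) — all three in THIS namespace,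
byte-identical (the `sorry`d copies below stay only until the farm serves those modules to this workfile; then
import them and delete the copies); the composition with the four inputs as hypotheses LANDED p107344
(`Theorems/…HeckeGraphChow`, registered stub `stub_heckeGraphAlgebraicOfInputs`) and the Hodge-type corollary
LANDED p107349 (`Theorems/…HeckeGraphChowHodgeType`, registered stub `stub_heckeHodgeTypeOfGraphAlgebraic`).
OPEN: S2b `stub_heckeGraphAnalytic` only. Its programme (registered stubs; ✓ landed): G1 `stub_properlyDiscontinuous` ⟸
`stub_properlyDiscontinuousOfBricks` ✓p108067 ⟸ `stub_congruenceBoundedFinite` + `stub_archimedeanBound` (τ₁-brick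
`stub_indefiniteUnitaryEntryBound` ✓p107948); consequences of G1 ✓: `stub_freeOfProperlyDiscontinuous` p107635,
`stub_ballLocallyCompactT2` p107937, `stub_levelCoveringOfProperlyDiscontinuous` p107526 (coverings + admissibility),
`stub_finiteIndexHeckeLevel` ✓p108444, `stub_heckeAdmissibleOfInputs` ✓p108657; inside G1: `stub_congruenceBoundedFinite` ✓p108331,
`stub_archimedeanBoundOfBricks` ✓p108471 ⟸ `stub_definiteUnitaryBounded` ✓p108224 + `stub_sylvesterEntryBound` ✓p108321 + `stub_cornerBound`
(worker file rc 0, landing); G2c `stub_graphAnalytic` ✓p108772 (corrected: T2Space N); G2b `stub_productAnalytification`, G2a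
`stub_unifHolomorphic` / `stub_unifLocalSection` REGISTERED (statements rc 0); only the S2b assembly is unregistered (promote-S2b.md).

`heckeGraphAlgebraic_of` below is the kernel-checked composition: from S0+T3 the action of `γ_g` is
`τ ∘ π_g^* = [Γ ∩ g⁻¹Γg : N_g] • T_g` EXACTLY (no orientation scalar), from S2a+S2b `γ_g` is
analytically supported in codimension `2(m+1)`, hence algebraic. Its conclusion is BYTE-IDENTICAL with
the derived theorem `heckeGraphAlgebraic` of `Lines/purity_sorted_hecke_envelope.lean` and
`Lines/hodge_tate_legible_envelope.lean`, so it replaces `stub_heckePushPull` there for that purpose.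
NOT replaced: the second use of `stub_heckePushPull` in `purity-sorted` (`heckeHodgeType`: the Hecke
algebra preserves Hodge types, via pull-back/Gysin of SCHEME morphisms) — with the topological graph this
needs either the named fact `Grothendieck1969_supportedClasses_le_hodgeConiveau` (algebraic classes on
`X ⊗ X` are `(2n,2n)`, then `corrAction` bookkeeping) or a holomorphic-correspondence lemma; recorded in
NOTES-c2-cycle1.md.
-/

noncomputable section

-- The crux-workfile namespace `Summit.<P>.<Sub>.Cruxes.…` repeats `HodgeConjecture` (single-conjunct summit).
set_option linter.dupNamespace false

namespace Summit.HodgeConjecture.HodgeConjecture.Cruxes.OrthogonalEnveloped.HeckeGraphChow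

open scoped BigOperators Manifold
open CategoryTheory MonoidalCategory CartesianMonoidalCategory
open Literature.AlgebraicGeometry.Motives (SchemeOver ComplexPoints IsSmoothProjective AlgPoints)
open Literature.AlgebraicGeometry.Motives (IsSmoothProjective.tensor_holds)
open Literature.AlgebraicGeometry.HodgeTheory
open Literature.AlgebraicGeometry.ShimuraVarieties
open Literature.AlgebraicTopology.SingularHomology
open Literature.Geometry.Kaehler (IsAnalyticSet regularLocus IsRegularPointOfCodim)
open Summit.HodgeConjecture.HodgeConjecture.Cruxes.OrthogonalEnveloped.ImpureBarrenEnvelope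
  (corrAction_gysinDiagonal_one gysinDiagonal_one_mem_algebraicClasses)

/-! ## Degree bookkeeping -/

/-- `2(m+1) + 2(m+1) = 2·2(m+1)`. [folklore] -/
theorem two_add_two (m : ℕ) : 2 * (m + 1) + 2 * (m + 1) = 2 * (2 * (m + 1)) := by ring

/-- `2·2(m+1) + 2·2(m+1) = 2(2(m+1) + 2(m+1))`: the degree of the Hecke graph class as a codegree
of the fundamental class of `(X ⊗ X)(ℂ)`. [folklore] -/
theorem four_add_four (m : ℕ) :
    2 * (2 * (m + 1)) + 2 * (2 * (m + 1)) = 2 * (2 * (m + 1) + 2 * (m + 1)) := by ring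

/-! ## The registered stubs (signatures in tree vocabulary; keep BYTE-IDENTICAL) -/

/-- **Stub S0 — the transfer of a homology class through a finite regular covering (KNOWN: Hatcher
§3.G; pure topology, L).** For a finite regular covering `p : E → B` with deck group `G` and a class
`ξ ∈ H_n(B; ℂ)` there is `θ ∈ H_n(E; ℂ)` (the CHAIN-level transfer `t_* ξ`, sum of the `G`-translates
of lifted simplices) such that `p_*(y ⌢ θ) = τ^*(y) ⌢ ξ` for every `y ∈ Hᵃ(E; ℂ)`, `τ^*` the tree's
cochain transfer `FiniteDeckCover.transferMap` (`(τψ)(σ) = Σ_g ψ(g σ̃)`): on a simplex `σ` of `B`,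
`p_♯(ψ ⌢ Σ_g gσ̃) = Σ_g ψ((gσ̃)|front) σ|back = (τ^♯ψ)(σ|front) σ|back = τ^♯ψ ⌢ σ`.
[cite: HatcherAT2002, §3.G p. 321 and §3.3 p. 239–241] -/
theorem stub_transferFundamentalClass :
    ∀ {G : Type} [Group G] [Fintype G] {E B : Type} [TopologicalSpace E] [TopologicalSpace B]
      [MulAction G E] (c : FiniteDeckCover G E B) {n : ℕ} (ξ : singularHomology ℂ ℂ B n),
      ∃ θ : singularHomology ℂ ℂ E n,
        ∀ (a b : ℕ) (hab : a + b = n) (y : singularCohomology ℂ ℂ E a),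
          singularHomology.map ℂ ℂ c.proj b (capProduct hab y θ) =
            capProduct hab (c.transferMap a y) ξ := by
  sorry

/-- **Stub T3 — the action of the Poincaré dual of a pushed-forward class is push–pull (KNOWN:
Fulton §16.1 Prop. 16.1.1 read topologically; M–L).** For `μ` with Poincaré duality, `X` smooth
projective of dimension `2(m+1)`, ANY space `L` with a continuous `F : L → (X ⊗ X)(ℂ)`, a class
`θ ∈ H_{4(m+1)}(L; ℂ)` and `γ ∈ H^{4(m+1)}((X ⊗ X)(ℂ); ℂ)` with `γ ⌢ [(X ⊗ X)(ℂ)] = F_* θ`: for every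
`β`, `P_γ β ⌢ [X(ℂ)] = (pr₁ ∘ F)_*((pr₂ ∘ F)^* β ⌢ θ)`, where `P_γ = corrAction μ hX hX rfl γ` is the
crux's `pr₁₊(pr₂^* β ∪ γ)` (`(pr₂^*β ∪ γ) ⌢ [Y] = pr₂^*β ⌢ (γ ⌢ [Y])` by graded commutativity and
`cupProduct_capProduct`, `= F_*(F^*pr₂^*β ⌢ θ)` by `capProduct_map`, and `pr₁₊ = D_X⁻¹ pr₁_* D_Y`).
[cite: Fulton1998, §16.1 Prop. 16.1.1] [cite: HatcherAT2002, §3.3 p. 241] -/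
theorem stub_topCorrAction :
    ∀ (μ : OrientationFamily), μ.HasPoincareDuality →
      ∀ (m : ℕ) (X : SchemeOver ℂ) (hX : IsSmoothProjective (2 * (m + 1)) X)
        (L : Type) [TopologicalSpace L] (F : C(L, ComplexPoints (X ⊗ X)))
        (θ : singularHomology ℂ ℂ L (2 * (2 * (m + 1))))
        (γ : complexBetti (X ⊗ X) (2 * (2 * (m + 1)))),
        capProduct (four_add_four m) γ (μ (IsSmoothProjective.tensor_holds hX hX)).fundamentalClass =
          singularHomology.map ℂ ℂ F (2 * (2 * (m + 1))) θ →
        ∀ β : complexBetti X (2 * (m + 1)),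
          capProduct (two_add_two m)
              (corrAction μ hX hX
                (rfl : 2 * (m + 1) + 2 * (2 * (m + 1)) = 2 * (m + 1) + 2 * (2 * (m + 1))) γ β)
              (μ hX).fundamentalClass =
            singularHomology.map ℂ ℂ ((AlgPoints.mapContinuous (L := ℂ) (fst X X)).comp F)
              (2 * (m + 1))
              (capProduct (two_add_two m)
                (singularCohomology.map ℂ ℂ ((AlgPoints.mapContinuous (L := ℂ) (snd X X)).comp F)
                  (2 * (m + 1)) β) θ) := by
  sorry

/-- **Stub S2a — the Poincaré dual of a class pushed forward from `L` dies off the image of `L`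
(KNOWN: Fulton, Young Tableaux App. B Ex. 5 / Bredon V.10, here in the elementary Čech form of the
tree's `gysinMap_restrictCompl_eq_zero_of_field`; M).** For `μ` with Poincaré duality, `Y` smooth
projective of dimension `n`, any `F : L → Y(ℂ)`, `θ ∈ H_q(L; ℂ)` and `γ ∈ Hᵇ(Y(ℂ); ℂ)` (`b + q = 2n`)
with `γ ⌢ [Y(ℂ)] = F_* θ`: `γ` restricts to `0` on `{P ∈ Y(ℂ) | P ∉ F(L)}`. Proof: pair with a
homology class `σ` of the complement, carried by a compact `C ⊆ Y(ℂ) ∖ F(L)`; `F_* θ` is carried by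
`Y(ℂ) ∖ C` (F factors through it), so `γ` dies near `C` by Čech–Poincaré duality along `C`
(`exists_isOpen_map_eq_zero_of_ofAbsolute_capProduct_eq_zero`), and `⟨γ|, σ⟩ = 0`
(`kroneckerPairing_injective_of_field`). [cite: FultonYoungTableaux1997, Appendix B §B.2 Exercise 5]
[cite: HatcherAT2002, §3.3 Thm. 3.44 and §3.1 Thm. 3.2] -/
theorem stub_vanishesOffImage :
    ∀ (μ : OrientationFamily), μ.HasPoincareDuality →
      ∀ (n : ℕ) (Y : SchemeOver ℂ) (hY : IsSmoothProjective n Y)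
        (L : Type) [TopologicalSpace L] (F : C(L, ComplexPoints Y))
        (b q : ℕ) (hb : b + q = 2 * n) (θ : singularHomology ℂ ℂ L q) (γ : complexBetti Y b),
        capProduct hb γ (μ hY).fundamentalClass = singularHomology.map ℂ ℂ F q θ →
        singularCohomology.map ℂ ℂ
          (⟨Subtype.val, continuous_subtype_val⟩ :
            C({P : ComplexPoints Y // P ∉ Set.range F}, ComplexPoints Y)) b γ = 0 := by
  sorry

/-- **Stub S2b — the Hecke graph is a closed analytic subset of `(X ⊗ X)^an` of codimension `dim X`
(KNOWN: BMM Part 2 §1.8; Shimura §7.2; XL — THE residual construction of the line).** For `m ∈ {1,2}`,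
a datum `D` on `X` (`dim X = 2(m+1)`), an admissible `g` and ANY Hodge model `A` of `X ⊗ X`: the
preimage in `A.carrier ≅ (X ⊗ X)(ℂ)` of the image of the topological Hecke graph
`N_g \ 𝔹 → (X ⊗ X)(ℂ)`, `ℓ ↦ (π ℓ, π_g ℓ)`, is a closed analytic subset all of whose regular points
have codimension `≥ 2(m+1)` (locally the graph of the holomorphic `π_g ∘ π⁻¹`; requires `unif|𝔹` to be
a local biholomorphism, i.e. `Γ` free and properly discontinuous on `𝔹`).
[cite: BergeronMillsonMoeglin2016Balls, Part 2 §1.8] [cite: Shimura1973, Ch. 7 §7.2] -/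
theorem stub_heckeGraphAnalytic :
    ∀ (m : ℕ) (X : SchemeOver ℂ) (D : UnitaryBallQuotientDatum (2 * (m + 1)) X), 1 ≤ m → m ≤ 2 →
      ∀ (g : GL (Fin (2 * (m + 1) + 1)) D.E) (h : D.IsHeckeAdmissible g)
        (A : HodgeModel (2 * (m + 1) + 2 * (m + 1)) (X ⊗ X)),
        IsAnalyticSet 𝓘(ℂ, A.model)
            (A.toComplexPoints ⁻¹' Set.range (fun ℓ : D.LevelCover (D.heckeLevel g) ↦
              (AlgPoints.prodEquiv (X := X) (Y := X) (L := ℂ)).symm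
                (D.levelProj (D.heckeLevel g) ℓ, UnitaryBallQuotientDatum.IsHeckeAdmissible.twist D h ℓ))) ∧
          ∀ x ∈ regularLocus 𝓘(ℂ, A.model)
              (A.toComplexPoints ⁻¹' Set.range (fun ℓ : D.LevelCover (D.heckeLevel g) ↦
                (AlgPoints.prodEquiv (X := X) (Y := X) (L := ℂ)).symm
                  (D.levelProj (D.heckeLevel g) ℓ, UnitaryBallQuotientDatum.IsHeckeAdmissible.twist D h ℓ))),
            ∀ q : ℕ, IsRegularPointOfCodim 𝓘(ℂ, A.model)
              (A.toComplexPoints ⁻¹' Set.range (fun ℓ : D.LevelCover (D.heckeLevel g) ↦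
                (AlgPoints.prodEquiv (X := X) (Y := X) (L := ℂ)).symm
                  (D.levelProj (D.heckeLevel g) ℓ, UnitaryBallQuotientDatum.IsHeckeAdmissible.twist D h ℓ))) q x →
              2 * (m + 1) ≤ q := by
  sorry

/-! ## The topological Hecke graph and its class -/

variable {m : ℕ} {X : SchemeOver ℂ}

/-- The **topological Hecke graph** `F_g : N_g \ 𝔹 → (X ⊗ X)(ℂ)`, `ℓ ↦ (π ℓ, π_g ℓ)` of an admissible
`g` (continuous: `levelProj`, `twist` are, and `(X ⊗ X)(ℂ) ≃ₜ X(ℂ) × X(ℂ)` by `AlgPoints.prodEquiv`).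
[cite: Shimura1973, Ch. 7 §7.2] -/
def heckeGraphMap (D : UnitaryBallQuotientDatum (2 * (m + 1)) X) {g : GL (Fin (2 * (m + 1) + 1)) D.E}
    (h : D.IsHeckeAdmissible g) : C(D.LevelCover (D.heckeLevel g), ComplexPoints (X ⊗ X)) :=
  ⟨fun ℓ ↦ (AlgPoints.prodEquiv (X := X) (Y := X) (L := ℂ)).symm (D.levelProj (D.heckeLevel g) ℓ, UnitaryBallQuotientDatum.IsHeckeAdmissible.twist D h ℓ),
    AlgPoints.continuous_prodEquiv_symm.comp
      ((D.levelProj (D.heckeLevel g)).continuous.prodMk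
        (UnitaryBallQuotientDatum.IsHeckeAdmissible.twist D h).continuous)⟩

/-- `pr₁ ∘ F_g = π` (the level projection). [cite: Shimura1973, Ch. 7 §7.2] -/
theorem fst_comp_heckeGraphMap (D : UnitaryBallQuotientDatum (2 * (m + 1)) X)
    {g : GL (Fin (2 * (m + 1) + 1)) D.E} (h : D.IsHeckeAdmissible g) :
    (AlgPoints.mapContinuous (L := ℂ) (fst X X)).comp (heckeGraphMap D h) =
      D.levelProj (D.heckeLevel g) := by
  refine ContinuousMap.ext fun ℓ ↦ ?_
  simp only [ContinuousMap.comp_apply, heckeGraphMap, ContinuousMap.coe_mk, AlgPoints.mapContinuous_apply]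
  rw [← AlgPoints.prodEquiv_apply_fst, Equiv.apply_symm_apply]

/-- `pr₂ ∘ F_g = π_g` (the twisted projection). [cite: Shimura1973, Ch. 7 §7.2] -/
theorem snd_comp_heckeGraphMap (D : UnitaryBallQuotientDatum (2 * (m + 1)) X)
    {g : GL (Fin (2 * (m + 1) + 1)) D.E} (h : D.IsHeckeAdmissible g) :
    (AlgPoints.mapContinuous (L := ℂ) (snd X X)).comp (heckeGraphMap D h) =
      UnitaryBallQuotientDatum.IsHeckeAdmissible.twist D h := by
  refine ContinuousMap.ext fun ℓ ↦ ?_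
  simp only [ContinuousMap.comp_apply, heckeGraphMap, ContinuousMap.coe_mk, AlgPoints.mapContinuous_apply]
  rw [← AlgPoints.prodEquiv_apply_snd, Equiv.apply_symm_apply]

/-! ## Analytic support from vanishing off the image -/

/-- **Transport of the vanishing to a Hodge model.** If a class `γ` on `Y(ℂ)` dies on the complement
of the image of `F : L → Y(ℂ)`, and that image read in a Hodge model `A` of `Y` is a closed analytic
subset all of whose regular points have codimension `≥ p`, then `γ` is analytically supported in
codimension `≥ p` (restriction commutes with the comparison homeomorphism `A.toComplexPoints`).
[cite: VoisinHodgeI2002, §11.1.2] [cite: SerreGAGA1956, §19 Prop. 13] -/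
theorem isAnalyticallySupported_of_vanishesOffImage {n : ℕ} {Y : SchemeOver ℂ} (A : HodgeModel n Y)
    {L : Type} [TopologicalSpace L] (F : C(L, ComplexPoints Y)) (p : ℕ) {k : ℕ}
    (γ : complexBetti Y k)
    (hS : IsAnalyticSet 𝓘(ℂ, A.model) (A.toComplexPoints ⁻¹' Set.range F) ∧
      ∀ x ∈ regularLocus 𝓘(ℂ, A.model) (A.toComplexPoints ⁻¹' Set.range F),
        ∀ q : ℕ, IsRegularPointOfCodim 𝓘(ℂ, A.model) (A.toComplexPoints ⁻¹' Set.range F) q x → p ≤ q)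
    (hvan : singularCohomology.map ℂ ℂ
      (⟨Subtype.val, continuous_subtype_val⟩ :
        C({P : ComplexPoints Y // P ∉ Set.range F}, ComplexPoints Y)) k γ = 0) :
    IsAnalyticallySupported A p γ := by
  refine ⟨A.toComplexPoints ⁻¹' Set.range F, hS, ?_⟩
  let ι : C({x : A.carrier // x ∉ A.toComplexPoints ⁻¹' Set.range F},
      {P : ComplexPoints Y // P ∉ Set.range F}) :=
    ⟨fun x ↦ ⟨A.toComplexPoints x.1, x.2⟩,
      (A.isAnalytification.isHomeomorph.continuous.comp continuous_subtype_val).subtype_mk _⟩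
  have hc : (⟨A.toComplexPoints, A.isAnalytification.isHomeomorph.continuous⟩ :
        C(A.carrier, ComplexPoints Y)).comp
      (⟨Subtype.val, continuous_subtype_val⟩ :
        C({x : A.carrier // x ∉ A.toComplexPoints ⁻¹' Set.range F}, A.carrier)) =
      (⟨Subtype.val, continuous_subtype_val⟩ :
        C({P : ComplexPoints Y // P ∉ Set.range F}, ComplexPoints Y)).comp ι :=
    ContinuousMap.ext fun x ↦ rfl
  have e1 : singularCohomology.map ℂ ℂ
        (⟨Subtype.val, continuous_subtype_val⟩ :
          C({x : A.carrier // x ∉ A.toComplexPoints ⁻¹' Set.range F}, A.carrier)) k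
        (A.pullback k γ) =
      singularCohomology.map ℂ ℂ ι k
        (singularCohomology.map ℂ ℂ
          (⟨Subtype.val, continuous_subtype_val⟩ :
            C({P : ComplexPoints Y // P ∉ Set.range F}, ComplexPoints Y)) k γ) := by
    rw [← ModuleCat.comp_apply, ← singularCohomology.map_comp, hc, singularCohomology.map_comp,
      ModuleCat.comp_apply]
  rw [e1, hvan, map_zero]

/-! ## The composition: `heckeGraphAlgebraic` from S0 + T3 + S2a + S2b -/

/-- **The Hecke graph class and its action (admissible `g`)**: with `θ` the transfer of `[X(ℂ)]_μ`
(Stub S0) and `γ_g := D_{X⊗X}⁻¹(F_{g*} θ)`, the crux's correspondence action of `γ_g` is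
`τ ∘ π_g^*` EXACTLY (Stub T3 + S0 + injectivity of `D_X`), and `γ_g` is algebraic (Stubs S2a + S2b:
analytically supported in codimension `2(m+1)`, then Chow + GAGA, both PROVED in the tree). Hence
`T_g = [Γ ∩ g⁻¹Γg : N_g]⁻¹ • τ ∘ π_g^*` is the action of the algebraic class `[Γ':N_g]⁻¹ • γ_g`.
[cite: BergeronMillsonMoeglin2016Balls, Part 2 §1.8 and Thm. 61] [cite: SerreGAGA1956, §19 Prop. 13] -/
theorem exists_algebraic_corrAction_eq_hecke_of_admissible {μ : OrientationFamily}
    (hμ : μ.HasPoincareDuality) (D : UnitaryBallQuotientDatum (2 * (m + 1)) X) (hm1 : 1 ≤ m)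
    (hm2 : m ≤ 2) {g : GL (Fin (2 * (m + 1) + 1)) D.E} (h : D.IsHeckeAdmissible g) :
    ∃ γ ∈ algebraicClasses (X ⊗ X) (2 * (m + 1)),
      corrAction μ D.isSmoothProjective D.isSmoothProjective
          (rfl : 2 * (m + 1) + 2 * (2 * (m + 1)) = 2 * (m + 1) + 2 * (2 * (m + 1))) γ =
        D.heckeCorrespondenceAction (2 * (m + 1)) g := by
  classical
  haveI : (D.heckeLevel g).FiniteIndex := h.finiteIndex
  letI : Fintype (↥D.Γ ⧸ D.heckeLevel g) := Subgroup.fintypeQuotientOfFiniteIndex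
  have hX := D.isSmoothProjective
  have hY := IsSmoothProjective.tensor_holds hX hX
  -- S0: the transfer `θ` of the fundamental class of `X(ℂ)` to the level cover
  obtain ⟨θ, hθ⟩ := stub_transferFundamentalClass
    (UnitaryBallQuotientDatum.IsHeckeAdmissible.deckCover D h) (μ hX).fundamentalClass
  -- the topological Hecke graph `F` (kept opaque) and its two projections
  obtain ⟨F, hF⟩ : ∃ F : C(D.LevelCover (D.heckeLevel g), ComplexPoints (X ⊗ X)),
      F = heckeGraphMap D h := ⟨_, rfl⟩
  have hfst : (AlgPoints.mapContinuous (L := ℂ) (fst X X)).comp F = D.levelProj (D.heckeLevel g) := by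
    rw [hF, fst_comp_heckeGraphMap]
  have hsnd : (AlgPoints.mapContinuous (L := ℂ) (snd X X)).comp F =
      UnitaryBallQuotientDatum.IsHeckeAdmissible.twist D h := by
    rw [hF, snd_comp_heckeGraphMap]
  have hrange : Set.range (fun ℓ : D.LevelCover (D.heckeLevel g) ↦
      (AlgPoints.prodEquiv (X := X) (Y := X) (L := ℂ)).symm
        (D.levelProj (D.heckeLevel g) ℓ, UnitaryBallQuotientDatum.IsHeckeAdmissible.twist D h ℓ)) =
      Set.range F := by
    rw [hF]
    rfl
  -- the graph class `γ₀ := D_Y⁻¹ (F_* θ)` (kept opaque: only `γ₀ ⌢ [Y] = F_* θ` is used)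
  obtain ⟨γ₀, hcap⟩ : ∃ γ₀ : complexBetti (X ⊗ X) (2 * (2 * (m + 1))),
      capProduct (four_add_four m) γ₀ (μ hY).fundamentalClass =
        singularHomology.map ℂ ℂ F (2 * (2 * (m + 1))) θ :=
    ⟨poincareDualityInv (μ hY) (four_add_four m) (singularHomology.map ℂ ℂ F (2 * (2 * (m + 1))) θ), by
      rw [← poincareDualityMap_apply, poincareDualityMap_poincareDualityInv (hμ hY (four_add_four m))]⟩
  -- T3 + S0: the action of `γ₀` is `τ ∘ π_g^*`
  have hact : ∀ β, corrAction μ hX hX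
      (rfl : 2 * (m + 1) + 2 * (2 * (m + 1)) = 2 * (m + 1) + 2 * (2 * (m + 1))) γ₀ β =
      (UnitaryBallQuotientDatum.IsHeckeAdmissible.deckCover D h).transferMap (R := ℂ) (2 * (m + 1))
        (singularCohomology.map ℂ ℂ (UnitaryBallQuotientDatum.IsHeckeAdmissible.twist D h)
          (2 * (m + 1)) β) := by
    intro β
    refine (hμ hX (two_add_two m)).1 ?_
    have key := stub_topCorrAction μ hμ m X hX (D.LevelCover (D.heckeLevel g)) F θ γ₀ hcap β
    rw [hfst, hsnd] at key
    rw [poincareDualityMap_apply, poincareDualityMap_apply, key]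
    exact hθ _ _ (two_add_two m) _
  -- S2a + S2b: `γ₀` is analytically supported in codimension `2(m+1)`, hence algebraic (Chow + GAGA)
  have halg : γ₀ ∈ algebraicClasses (X ⊗ X) (2 * (m + 1)) := by
    obtain ⟨A⟩ := nonempty_hodgeModel_holds.nonempty hY
    have hS := stub_heckeGraphAnalytic m X D hm1 hm2 g h A
    rw [hrange] at hS
    exact IsAnalyticallySupported.mem_algebraicClasses gaga_le_coheight_of_regularLocus_codim_holds hY
      (isAnalyticallySupported_of_vanishesOffImage A F (2 * (m + 1)) γ₀ hS
        (stub_vanishesOffImage μ hμ _ (X ⊗ X) hY (D.LevelCover (D.heckeLevel g)) F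
          (2 * (2 * (m + 1))) (2 * (2 * (m + 1))) (four_add_four m) θ γ₀ hcap))
  -- conclusion: `T_g = [Γ' : N_g]⁻¹ • τ ∘ π_g^*` is the action of `[Γ' : N_g]⁻¹ • γ₀`
  refine ⟨((D.heckeIndex g : ℂ)⁻¹) • γ₀, Submodule.smul_mem _ _ halg, LinearMap.ext fun β ↦ ?_⟩
  rw [D.heckeCorrespondenceAction_apply h]
  dsimp only
  rw [map_smul, LinearMap.smul_apply, hact β]

/-- **Non-admissible `g`: `T_g = 0 = P_0`.** [folklore] -/
theorem exists_algebraic_corrAction_eq_hecke_of_not (μ : OrientationFamily)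
    (D : UnitaryBallQuotientDatum (2 * (m + 1)) X) {g : GL (Fin (2 * (m + 1) + 1)) D.E}
    (hg : ¬ D.IsHeckeAdmissible g) :
    ∃ γ ∈ algebraicClasses (X ⊗ X) (2 * (m + 1)),
      corrAction μ D.isSmoothProjective D.isSmoothProjective
          (rfl : 2 * (m + 1) + 2 * (2 * (m + 1)) = 2 * (m + 1) + 2 * (2 * (m + 1))) γ =
        D.heckeCorrespondenceAction (2 * (m + 1)) g :=
  ⟨0, zero_mem _, by rw [map_zero, D.heckeCorrespondenceAction_of_not hg]⟩

/-- **Hecke operators are actions of algebraic self-correspondences — via Chow, without algebraizing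
the level covers.** Byte-identical conclusion with the derived theorem `heckeGraphAlgebraic` of lines
`purity-sorted-hecke-envelope` / `hodge-tate-legible-envelope` (there from `stub_heckePushPull`); here
from Stubs S0, T3, S2a, S2b. [cite: BergeronMillsonMoeglin2016Balls, Part 2 §1.8 and Thm. 61]
[cite: SerreGAGA1956, §19 Prop. 13] -/
theorem heckeGraphAlgebraic_of :
    ∀ (μ : OrientationFamily), μ.HasPoincareDuality →
      ∀ (m : ℕ) (X : SchemeOver ℂ) (D : UnitaryBallQuotientDatum (2 * (m + 1)) X), 1 ≤ m → m ≤ 2 →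
        ∀ g : GL (Fin (2 * (m + 1) + 1)) D.E,
          ∃ γ ∈ algebraicClasses (X ⊗ X) (2 * (m + 1)),
            corrAction μ D.isSmoothProjective D.isSmoothProjective
                (rfl : 2 * (m + 1) + 2 * (2 * (m + 1)) = 2 * (m + 1) + 2 * (2 * (m + 1))) γ =
              D.heckeCorrespondenceAction (2 * (m + 1)) g := by
  intro μ hμ m X D hm1 hm2 g
  by_cases hadm : D.IsHeckeAdmissible g
  · exact exists_algebraic_corrAction_eq_hecke_of_admissible hμ D hm1 hm2 hadm
  · exact exists_algebraic_corrAction_eq_hecke_of_not μ D hadm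

/-! ## The second use of `stub_heckePushPull`: the Hecke algebra preserves Hodge types — here
CONDITIONAL on the named fact `Grothendieck1969_supportedClasses_le_hodgeConiveau` (Deligne, Hodge II) -/

/-- **An algebraic class on `X ⊗ X` in degree `2·dim X` is of type `(dim X, dim X)`**, GRANTED
`Grothendieck1969_supportedClasses_le_hodgeConiveau` (`N^s H^{2s} ⊆` Hodge coniveau `≥ s`, and in degree
`2s` the only piece of coniveau `≥ s` is `H^{s,s}`). [cite: GrothendieckTopology1969, p. 299 (∗) and p. 300]
[cite: VoisinHodgeI2002, §7.1.1] -/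
theorem isOfHodgeType_of_mem_algebraicClasses_of_grothendieck
    (hG : Grothendieck1969_supportedClasses_le_hodgeConiveau) {n : ℕ} {Y : SchemeOver ℂ}
    (hY : IsSmoothProjective n Y) {s : ℕ} {γ : complexBetti Y (2 * s)}
    (hγ : γ ∈ algebraicClasses Y s) : IsOfHodgeType n Y (2 * s) s s γ := by
  obtain ⟨A⟩ := nonempty_hodgeModel_holds.nonempty hY
  refine ⟨A, ?_⟩
  have h := hG hY A (2 * s) s ⟨γ, hγ, rfl⟩
  refine (iSup_le fun p ↦ iSup_le fun q ↦ iSup_le fun hpq ↦ iSup_le fun hp ↦ iSup_le fun hq ↦ ?_ :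
    A.hodgeConiveau (2 * s) s ≤ A.hodgePQ (2 * s) s s) h
  obtain rfl : p = s := by omega
  obtain rfl : q = p := by omega
  exact le_rfl

/-- **The action of an ALGEBRAIC self-correspondence preserves every Hodge type**, GRANTED
`Grothendieck1969_supportedClasses_le_hodgeConiveau`: `P_γ β = pr₁₊(pr₂^* β ∪ γ)` with `pr₂^*` of
bidegree `(0,0)` (`IsOfHodgeType.map_of_independent`), `∪ γ` of bidegree `(n,n)` for `γ` of type `(n,n)`
(`cupPreservesHodgeType_of_nonempty_hodgeModel`, de Rham's theorem in multiplicative form), and `pr₁₊` of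
bidegree `(-n,-n)` (`isOfHodgeType_complexGysin`), `n = dim X`. [cite: VoisinHodgeI2002, §7.3.2 (with Lemma 7.30) and §11.3.3]
[cite: GrothendieckTopology1969, p. 300] -/
theorem isOfHodgeType_corrAction_of_grothendieck
    (hG : Grothendieck1969_supportedClasses_le_hodgeConiveau) (μ : OrientationFamily)
    (hX : IsSmoothProjective (2 * (m + 1)) X) {γ : complexBetti (X ⊗ X) (2 * (2 * (m + 1)))}
    (hγ : γ ∈ algebraicClasses (X ⊗ X) (2 * (m + 1))) {p q : ℕ} {β : complexBetti X (2 * (m + 1))}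
    (hβ : IsOfHodgeType (2 * (m + 1)) X (2 * (m + 1)) p q β) :
    IsOfHodgeType (2 * (m + 1)) X (2 * (m + 1)) p q
      (corrAction μ hX hX
        (rfl : 2 * (m + 1) + 2 * (2 * (m + 1)) = 2 * (m + 1) + 2 * (2 * (m + 1))) γ β) := by
  have hY := IsSmoothProjective.tensor_holds hX hX
  have hI := hodgePQ_independent_of_hodgeModel_holds
  have hM : ∀ (k : ℕ) (Z : SchemeOver ℂ), nonempty_hodgeModel k Z := fun _ _ ↦ nonempty_hodgeModel_holds
  have hdR : ∀ (E : Type) [NormedAddCommGroup E] [NormedSpace ℂ E] [FiniteDimensional ℂ E],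
      Literature.NumberTheory.Transcendental.exists_deRhamIsoFamily 𝓘(ℝ, E) :=
    fun E _ _ _ ↦ Literature.NumberTheory.Transcendental.exists_deRhamIsoFamily_holds (E := E)
  obtain ⟨B⟩ := nonempty_hodgeModel_holds.nonempty hY
  -- `pr₂^* β` is of type `(p, q)` and `γ` of type `(n, n)` on `X ⊗ X`
  have h2 : IsOfHodgeType (2 * (m + 1) + 2 * (m + 1)) (X ⊗ X) (2 * (m + 1)) p q
      (complexBetti.map (snd X X) (2 * (m + 1)) β) :=
    hβ.map_of_independent hI hY hX B (snd X X)
  have hγt : IsOfHodgeType (2 * (m + 1) + 2 * (m + 1)) (X ⊗ X) (2 * (2 * (m + 1)))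
      (2 * (m + 1)) (2 * (m + 1)) γ :=
    isOfHodgeType_of_mem_algebraicClasses_of_grothendieck hG hY hγ
  -- their cup product is of type `(p + n, q + n)`
  have hcup := cupPreservesHodgeType_of_nonempty_hodgeModel hI (hM _ _) hdR hY
    (rfl : 2 * (m + 1) + 2 * (2 * (m + 1)) = 2 * (m + 1) + 2 * (2 * (m + 1))) h2 hγt
  -- and `pr₁₊` brings it back to type `(p, q)`
  rw [corrAction_apply]
  exact isOfHodgeType_complexGysin hI hM hdR μ hY hX (fst X X) _
    (p := p + 2 * (m + 1)) (q := q + 2 * (m + 1)) (by omega) (by omega) hcup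

/-- **The Hecke operators preserve every Hodge type** — from `heckeGraphAlgebraic_of` (Stubs S0, T3,
S2a, S2b) and `Grothendieck1969_supportedClasses_le_hodgeConiveau`; replaces the second use of
`stub_heckePushPull` (`isOfHodgeType_heckeCorrespondenceAction` / `heckeHodgeType` of line
`purity-sorted-hecke-envelope`) by a CONDITIONAL result on one published named fact.
[cite: BergeronMillsonMoeglin2016Balls, Part 2 §1.8 and Thm. 61] [cite: GrothendieckTopology1969, p. 300] -/
theorem isOfHodgeType_heckeCorrespondenceAction_of_grothendieck
    (hG : Grothendieck1969_supportedClasses_le_hodgeConiveau) {μ : OrientationFamily}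
    (hμ : μ.HasPoincareDuality) (D : UnitaryBallQuotientDatum (2 * (m + 1)) X) (hm1 : 1 ≤ m)
    (hm2 : m ≤ 2) (g : GL (Fin (2 * (m + 1) + 1)) D.E) {p q : ℕ} {β : complexBetti X (2 * (m + 1))}
    (hβ : IsOfHodgeType (2 * (m + 1)) X (2 * (m + 1)) p q β) :
    IsOfHodgeType (2 * (m + 1)) X (2 * (m + 1)) p q (D.heckeCorrespondenceAction (2 * (m + 1)) g β) := by
  obtain ⟨γ, hγ, hP⟩ := heckeGraphAlgebraic_of μ hμ m X D hm1 hm2 g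
  rw [← hP]
  exact isOfHodgeType_corrAction_of_grothendieck hG μ D.isSmoothProjective hγ hβ

end Summit.HodgeConjecture.HodgeConjecture.Cruxes.OrthogonalEnveloped.HeckeGraphChow

end
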